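import Summits.ValiantsHypothesis.ValiantsHypothesis.Theorems.BarrierLeverPartitionMinorsHitByVPCubeBallRows
import Literature.Combinatorics.Posets.BooleanOrderRaising

/-!
# Route BarrierLever — item `PartitionMinorsHitByVP` (stmt-ValiantsHypothesis-19717):
# CUBE versus HAMMING BALL, part 2/2 — the stress pair is hit AT EVERY HEIGHT (Lefschetz mechanism)

Link file (`--supports stmt-ValiantsHypothesis-19717`; cell valiant-natproofs, rung V4, 𝒟-side door (c);
prover seat val-np-p1 gen 14). Definition-free. Closes NO item.

**Theorem (`det_cubeBall_witness_ne_zero`, `cubeBall_hit`).** For every `k ≥ 1` (`h = 2k+1`) the layout «all subsets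
of the `2k` `x`-vertices `{0,…,2k−1}`» × «all subsets of size `≤ k` of the `2k+1` `y`-vertices» (both of size `4^k`;
rows enumerated by ANY injective `u` avoiding `x_{2k}`, columns by any `w` whose range contains the ball) has a nonsingular
partition-matrix minor at the brick product `witness k k` of part 1, hence at some `f ∈ SmallCircuits ℂ (h+h) 8`.

**Proof (`rows_independent`, induction on `j ≤ k`).** `P(j)`: the rows `S ⊆ X_j` of `F_j` restricted to the columns
`T ⊆ Y_j`, `|T| ≤ j`, are linearly independent. For `P(j+1)` split a vanishing combination by the row types
`S, S+a, S+b, S+a+b` (`S ⊆ X_j`; coefficients `c₀, c_a, c_b, c_ab`) and test it, via the row rules of part 1, on the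
column types `a'+T″` (only `Σ c_a F_j[·,T″]` survives ⇒ `c_a = 0` by `P(j)`), `b'+T″` (`c_b = 0`), `a'b'+T″` with
`|T″| ≤ j−1` (`B := Σ c_ab F_j[·,·]` vanishes below rank `j`) and `T ⊆ Y_j` (`A(T) + Σ_{d∈T} B(T∖d) = 0`,
`A := Σ c₀ F_j[·,·]`): at `|T| ≤ j` this gives `A = 0` (`c₀ = 0`), and at `|T| = j+1` it says that Stanley's
order-raising operator of the Boolean lattice on `Y_j` (`|Y_j| = 2j+1 > 2j`) kills the rank-`j` function `B`, so
`B = 0` on rank `j` by HARD LEFSCHETZ (`BooleanOrderRaising.eq_zero_of_forall_sum_erase_eq_zero`) and `c_ab = 0` by `P(j)`.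
(«Defect transfer at an unequal split», seat memo HOME/val-np-p1/g14/ANCHORED-MEMO-valnp1-g14.md §4.)

WHAT THIS IS NOT: one layout family, not item 19717; nothing on crux stmt-ValiantsHypothesis-14610 or `VP` versus `VNP`.
-/

set_option linter.dupNamespace false

namespace Summit.ValiantsHypothesis.ValiantsHypothesis.Theorems.BarrierLever.CubeBall

open Finset MvPolynomial
open Literature.Barriers.ValiantsHypothesis Literature.Computability.AlgebraicComplexity
open Summit.ValiantsHypothesis.ValiantsHypothesis.Theorems.BarrierLever.BrickCalculus
open Summit.ValiantsHypothesis.ValiantsHypothesis.Theorems.BarrierLever.AdditiveDoor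
  (truncation_spec degree_partitionExpo_le)

noncomputable section
/-! ## 1. Row independence by induction (the Lefschetz step) -/

/-- Splitting a sum over the subsets of `X_{j+1} = X_j ∪ {a, b}` by the four row types. -/
theorem sum_powerset_xSet_succ {k j : ℕ} (hj : j < k) (g : Finset (Fin (2 * k + 1)) → ℂ) :
    ∑ S ∈ (xSet k (j + 1)).powerset, g S = ∑ S ∈ (xSet k j).powerset, g S +
      ∑ S ∈ (xSet k j).powerset, g (insert (vtx k (2 * j + 1)) S) +
      (∑ S ∈ (xSet k j).powerset, g (insert (vtx k (2 * j)) S) +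
        ∑ S ∈ (xSet k j).powerset, g (insert (vtx k (2 * j)) (insert (vtx k (2 * j + 1)) S))) := by
  have hb : vtx k (2 * j + 1) ∉ xSet k j := vtx_odd_not_mem_xSet hj
  have ha : vtx k (2 * j) ∉ insert (vtx k (2 * j + 1)) (xSet k j) := fun hm => by
    rcases Finset.mem_insert.mp hm with hv | hv
    · exact vtx_two_mul_ne hj hv
    · exact vtx_even_not_mem_xSet hj hv
  rw [xSet_succ, Finset.sum_powerset_insert ha, Finset.sum_powerset_insert hb, Finset.sum_powerset_insert hb]

/-- **Row independence.** For `j ≤ k`, the rows `S ⊆ X_j` of `F_j` restricted to the columns `T ⊆ Y_j` with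
`|T| ≤ j` are linearly independent: a coefficient function `c` killing all these columns vanishes on `𝒫(X_j)`. -/
theorem rows_independent (k : ℕ) : ∀ j, j ≤ k → ∀ c : Finset (Fin (2 * k + 1)) → ℂ,
    (∀ T, T ⊆ ySet k j → T.card ≤ j →
      ∑ S ∈ (xSet k j).powerset, c S * coeff (pexpo S T) (witness k j) = 0) →
    ∀ S ∈ (xSet k j).powerset, c S = 0 := by
  intro j
  induction j with
  | zero =>
    intro _ c hc S hS
    have hX : xSet k 0 = ∅ := by simp [xSet]
    rw [hX, Finset.powerset_empty, Finset.mem_singleton] at hS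
    subst hS
    have h0 := hc ∅ (Finset.empty_subset _) le_rfl
    rw [hX, Finset.powerset_empty, Finset.sum_singleton] at h0
    have hcoeff : coeff (pexpo (∅ : Finset (Fin (2 * k + 1))) ∅) (witness k 0) = 1 := by
      rw [witness]; simp [pexpo]
    rw [hcoeff, mul_one] at h0
    exact h0
  | succ j ih =>
    intro hjk c hc
    have hj : j < k := hjk
    have ihj := ih hj.le
    -- names
    have haX : vtx k (2 * j) ∉ xSet k j := vtx_even_not_mem_xSet hj
    have hbX : vtx k (2 * j + 1) ∉ xSet k j := vtx_odd_not_mem_xSet hj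
    have haY : vtx k (2 * j) ∉ ySet k j := vtx_even_not_mem_ySet hj
    have hbY : vtx k (2 * j + 1) ∉ ySet k j := vtx_odd_not_mem_ySet hj
    have hab : vtx k (2 * j) ≠ vtx k (2 * j + 1) := vtx_two_mul_ne hj
    have hYsub : ySet k j ⊆ ySet k (j + 1) := ySet_subset_succ k j
    have haY' : vtx k (2 * j) ∈ ySet k (j + 1) := by rw [ySet_succ]; exact Finset.mem_insert_self _ _
    have hbY' : vtx k (2 * j + 1) ∈ ySet k (j + 1) := by
      rw [ySet_succ]; exact Finset.mem_insert_of_mem (Finset.mem_insert_self _ _)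
    -- rows of `F_j` vanish on columns outside `Y_j`
    have hcol0 : ∀ S W, ¬ W ⊆ ySet k j → coeff (pexpo S W) (witness k j) = 0 := fun S W hW =>
      coeff_witness_eq_zero_of_not_subset hj.le S W (fun hc' => hW hc'.2)
    -- the hypothesis, split by row type, for `S ⊆ X_j`
    have H : ∀ T, T ⊆ ySet k (j + 1) → T.card ≤ j + 1 →
        ∑ S ∈ (xSet k j).powerset, c S * coeff (pexpo S T) (witness k j) +
        ∑ S ∈ (xSet k j).powerset, c (insert (vtx k (2 * j + 1)) S) *
          (if vtx k (2 * j + 1) ∈ T then coeff (pexpo S (T.erase (vtx k (2 * j + 1)))) (witness k j) else 0) +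
        (∑ S ∈ (xSet k j).powerset, c (insert (vtx k (2 * j)) S) *
          (if vtx k (2 * j) ∈ T then coeff (pexpo S (T.erase (vtx k (2 * j)))) (witness k j) else 0) +
        ∑ S ∈ (xSet k j).powerset, c (insert (vtx k (2 * j)) (insert (vtx k (2 * j + 1)) S)) *
          ((if vtx k (2 * j) ∈ T ∧ vtx k (2 * j + 1) ∈ T then
              coeff (pexpo S ((T.erase (vtx k (2 * j + 1))).erase (vtx k (2 * j)))) (witness k j) else 0) +
            ∑ d ∈ (ySet k j).filter (· ∈ T), coeff (pexpo S (T.erase d)) (witness k j))) = 0 := by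
      intro T hT hTc
      have h0 := hc T hT hTc
      rw [sum_powerset_xSet_succ hj] at h0
      have e1 : ∑ S ∈ (xSet k j).powerset, c S * coeff (pexpo S T) (witness k (j + 1)) =
          ∑ S ∈ (xSet k j).powerset, c S * coeff (pexpo S T) (witness k j) :=
        Finset.sum_congr rfl (fun S hS => by rw [coeff_witness_succ_none hj S (Finset.mem_powerset.mp hS)])
      have e2 : ∑ S ∈ (xSet k j).powerset, c (insert (vtx k (2 * j + 1)) S) *
            coeff (pexpo (insert (vtx k (2 * j + 1)) S) T) (witness k (j + 1)) =
          ∑ S ∈ (xSet k j).powerset, c (insert (vtx k (2 * j + 1)) S) *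
            (if vtx k (2 * j + 1) ∈ T then coeff (pexpo S (T.erase (vtx k (2 * j + 1)))) (witness k j) else 0) :=
        Finset.sum_congr rfl (fun S hS => by rw [coeff_witness_succ_right hj S (Finset.mem_powerset.mp hS)])
      have e3 : ∑ S ∈ (xSet k j).powerset, c (insert (vtx k (2 * j)) S) *
            coeff (pexpo (insert (vtx k (2 * j)) S) T) (witness k (j + 1)) =
          ∑ S ∈ (xSet k j).powerset, c (insert (vtx k (2 * j)) S) *
            (if vtx k (2 * j) ∈ T then coeff (pexpo S (T.erase (vtx k (2 * j)))) (witness k j) else 0) :=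
        Finset.sum_congr rfl (fun S hS => by rw [coeff_witness_succ_left hj S (Finset.mem_powerset.mp hS)])
      have e4 : ∑ S ∈ (xSet k j).powerset, c (insert (vtx k (2 * j)) (insert (vtx k (2 * j + 1)) S)) *
            coeff (pexpo (insert (vtx k (2 * j)) (insert (vtx k (2 * j + 1)) S)) T) (witness k (j + 1)) =
          ∑ S ∈ (xSet k j).powerset, c (insert (vtx k (2 * j)) (insert (vtx k (2 * j + 1)) S)) *
          ((if vtx k (2 * j) ∈ T ∧ vtx k (2 * j + 1) ∈ T then
              coeff (pexpo S ((T.erase (vtx k (2 * j + 1))).erase (vtx k (2 * j)))) (witness k j) else 0) +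
            ∑ d ∈ (ySet k j).filter (· ∈ T), coeff (pexpo S (T.erase d)) (witness k j)) :=
        Finset.sum_congr rfl (fun S hS => by rw [coeff_witness_succ_both hj S (Finset.mem_powerset.mp hS)])
      rw [e1, e2, e3, e4] at h0
      exact h0
    -- (β) columns `a' + T″`: `c_a = 0`
    have hca : ∀ S ∈ (xSet k j).powerset, c (insert (vtx k (2 * j)) S) = 0 := by
      refine ihj (fun S => c (insert (vtx k (2 * j)) S)) (fun T'' hT'' hTc'' => ?_)
      have haT'' : vtx k (2 * j) ∉ T'' := fun hm => haY (hT'' hm)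
      have hbT : vtx k (2 * j + 1) ∉ insert (vtx k (2 * j)) T'' := fun hm => by
        rcases Finset.mem_insert.mp hm with hv | hv
        · exact hab hv.symm
        · exact hbY (hT'' hv)
      have h1 := H (insert (vtx k (2 * j)) T'') (Finset.insert_subset haY' (hT''.trans hYsub))
        (by rw [Finset.card_insert_of_notMem haT'']; omega)
      have hnot : ¬ insert (vtx k (2 * j)) T'' ⊆ ySet k j := fun hsub => haY (hsub (Finset.mem_insert_self _ _))
      simp only [hcol0 _ _ hnot, mul_zero, Finset.sum_const_zero, zero_add,
        if_pos (Finset.mem_insert_self _ T''), Finset.erase_insert haT'', hbT, and_false, if_false] at h1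
      -- the fan terms vanish: `T ∖ d ∋ a'`
      have hfan : ∀ S, ∑ d ∈ (ySet k j).filter (· ∈ insert (vtx k (2 * j)) T''),
          coeff (pexpo S ((insert (vtx k (2 * j)) T'').erase d)) (witness k j) = 0 := by
        intro S
        refine Finset.sum_eq_zero (fun d hd => hcol0 _ _ (fun hsub => haY (hsub ?_)))
        have hdY : d ∈ ySet k j := (Finset.mem_filter.mp hd).1
        exact Finset.mem_erase.mpr ⟨fun hda => haY (hda ▸ hdY), Finset.mem_insert_self _ _⟩
      simp only [hfan, mul_zero, Finset.sum_const_zero, add_zero] at h1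
      exact h1
    -- (γ) columns `b' + T″`: `c_b = 0`
    have hcb : ∀ S ∈ (xSet k j).powerset, c (insert (vtx k (2 * j + 1)) S) = 0 := by
      refine ihj (fun S => c (insert (vtx k (2 * j + 1)) S)) (fun T'' hT'' hTc'' => ?_)
      have hbT'' : vtx k (2 * j + 1) ∉ T'' := fun hm => hbY (hT'' hm)
      have haT : vtx k (2 * j) ∉ insert (vtx k (2 * j + 1)) T'' := fun hm => by
        rcases Finset.mem_insert.mp hm with hv | hv
        · exact hab hv
        · exact haY (hT'' hv)
      have h1 := H (insert (vtx k (2 * j + 1)) T'') (Finset.insert_subset hbY' (hT''.trans hYsub))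
        (by rw [Finset.card_insert_of_notMem hbT'']; omega)
      have hnot : ¬ insert (vtx k (2 * j + 1)) T'' ⊆ ySet k j :=
        fun hsub => hbY (hsub (Finset.mem_insert_self _ _))
      simp only [hcol0 _ _ hnot, mul_zero, Finset.sum_const_zero, zero_add,
        if_pos (Finset.mem_insert_self _ T''), Finset.erase_insert hbT'', haT, false_and, if_false] at h1
      have hfan : ∀ S, ∑ d ∈ (ySet k j).filter (· ∈ insert (vtx k (2 * j + 1)) T''),
          coeff (pexpo S ((insert (vtx k (2 * j + 1)) T'').erase d)) (witness k j) = 0 := by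
        intro S
        refine Finset.sum_eq_zero (fun d hd => hcol0 _ _ (fun hsub => hbY (hsub ?_)))
        have hdY : d ∈ ySet k j := (Finset.mem_filter.mp hd).1
        exact Finset.mem_erase.mpr ⟨fun hdb => hbY (hdb ▸ hdY), Finset.mem_insert_self _ _⟩
      simp only [hfan, mul_zero, Finset.sum_const_zero, add_zero] at h1
      exact h1
    -- (δ) columns `a' b' + T″`, `|T″| ≤ j - 1`: `B = 0` below rank `j`
    have hB_low : ∀ T'', T'' ⊆ ySet k j → T''.card + 1 ≤ j →
        ∑ S ∈ (xSet k j).powerset, c (insert (vtx k (2 * j)) (insert (vtx k (2 * j + 1)) S)) *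
          coeff (pexpo S T'') (witness k j) = 0 := by
      intro T'' hT'' hTc''
      have haT'' : vtx k (2 * j) ∉ T'' := fun hm => haY (hT'' hm)
      have hbT'' : vtx k (2 * j + 1) ∉ T'' := fun hm => hbY (hT'' hm)
      have hbT1 : vtx k (2 * j + 1) ∈ insert (vtx k (2 * j)) (insert (vtx k (2 * j + 1)) T'') :=
        Finset.mem_insert_of_mem (Finset.mem_insert_self _ _)
      have haT1 : vtx k (2 * j) ∈ insert (vtx k (2 * j)) (insert (vtx k (2 * j + 1)) T'') :=
        Finset.mem_insert_self _ _
      have haT2 : vtx k (2 * j) ∉ insert (vtx k (2 * j + 1)) T'' := fun hm => by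
        rcases Finset.mem_insert.mp hm with hv | hv
        · exact hab hv
        · exact haT'' hv
      have h1 := H (insert (vtx k (2 * j)) (insert (vtx k (2 * j + 1)) T''))
        (Finset.insert_subset haY' (Finset.insert_subset hbY' (hT''.trans hYsub)))
        (by rw [Finset.card_insert_of_notMem haT2, Finset.card_insert_of_notMem hbT'']; omega)
      have hnot : ¬ insert (vtx k (2 * j)) (insert (vtx k (2 * j + 1)) T'') ⊆ ySet k j :=
        fun hsub => haY (hsub haT1)
      have hnot_a : ¬ (insert (vtx k (2 * j)) (insert (vtx k (2 * j + 1)) T'')).erase (vtx k (2 * j + 1)) ⊆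
          ySet k j := fun hsub => haY (hsub (Finset.mem_erase.mpr ⟨hab, haT1⟩))
      have hnot_b : ¬ (insert (vtx k (2 * j)) (insert (vtx k (2 * j + 1)) T'')).erase (vtx k (2 * j)) ⊆
          ySet k j := fun hsub => hbY (hsub (Finset.mem_erase.mpr ⟨hab.symm, hbT1⟩))
      have hfan : ∀ S, ∑ d ∈ (ySet k j).filter (· ∈ insert (vtx k (2 * j)) (insert (vtx k (2 * j + 1)) T'')),
          coeff (pexpo S ((insert (vtx k (2 * j)) (insert (vtx k (2 * j + 1)) T'')).erase d)) (witness k j) = 0 := by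
        intro S
        refine Finset.sum_eq_zero (fun d hd => hcol0 _ _ (fun hsub => haY (hsub ?_)))
        have hdY : d ∈ ySet k j := (Finset.mem_filter.mp hd).1
        exact Finset.mem_erase.mpr ⟨fun hda => haY (hda ▸ hdY), haT1⟩
      have herase : ((insert (vtx k (2 * j)) (insert (vtx k (2 * j + 1)) T'')).erase (vtx k (2 * j + 1))).erase
          (vtx k (2 * j)) = T'' := by
        rw [Finset.erase_insert_of_ne hab, Finset.erase_insert hbT'', Finset.erase_insert haT'']
      simp only [hcol0 _ _ hnot, hcol0 _ _ hnot_a, hcol0 _ _ hnot_b, mul_zero, Finset.sum_const_zero, zero_add,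
        if_pos hbT1, if_pos haT1, if_pos (And.intro haT1 hbT1), herase, hfan, add_zero] at h1
      exact h1
    -- (α) columns `T ⊆ Y_j`
    have hA : ∀ T, T ⊆ ySet k j → T.card ≤ j + 1 →
        ∑ S ∈ (xSet k j).powerset, c S * coeff (pexpo S T) (witness k j) +
        ∑ S ∈ (xSet k j).powerset, c (insert (vtx k (2 * j)) (insert (vtx k (2 * j + 1)) S)) *
          ∑ d ∈ T, coeff (pexpo S (T.erase d)) (witness k j) = 0 := by
      intro T hT hTc
      have haT : vtx k (2 * j) ∉ T := fun hm => haY (hT hm)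
      have hbT : vtx k (2 * j + 1) ∉ T := fun hm => hbY (hT hm)
      have h1 := H T (hT.trans hYsub) hTc
      have hfilter : (ySet k j).filter (· ∈ T) = T := by
        ext d; simp only [Finset.mem_filter]; exact ⟨fun h' => h'.2, fun h' => ⟨hT h', h'⟩⟩
      simp only [if_neg hbT, haT, false_and, if_false, mul_zero, Finset.sum_const_zero, add_zero,
        zero_add, hfilter] at h1
      exact h1
    -- `c₀ = 0`: at `|T| ≤ j` the fan terms vanish by (δ)
    have hc0 : ∀ S ∈ (xSet k j).powerset, c S = 0 := by
      refine ihj c (fun T hT hTc => ?_)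
      have h1 := hA T hT (by omega)
      have hfan : ∑ S ∈ (xSet k j).powerset, c (insert (vtx k (2 * j)) (insert (vtx k (2 * j + 1)) S)) *
          ∑ d ∈ T, coeff (pexpo S (T.erase d)) (witness k j) = 0 := by
        rw [Finset.sum_congr rfl (fun S _ => Finset.mul_sum _ _ _), Finset.sum_comm]
        refine Finset.sum_eq_zero (fun d hd => ?_)
        exact hB_low (T.erase d) ((Finset.erase_subset _ _).trans hT)
          (by have := Finset.card_pos.mpr ⟨d, hd⟩; rw [Finset.card_erase_of_mem hd]; omega)
      rw [hfan, add_zero] at h1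
      exact h1
    -- `B = 0` on rank `j` by hard Lefschetz on the Boolean lattice of `Y_j` (`|Y_j| = 2j+1 > 2j`)
    have hB_top : ∀ T'', T'' ⊆ ySet k j → T''.card = j →
        ∑ S ∈ (xSet k j).powerset, c (insert (vtx k (2 * j)) (insert (vtx k (2 * j + 1)) S)) *
          coeff (pexpo S T'') (witness k j) = 0 := by
      classical
      -- the rank-`j` function on subsets of `Y_j`
      let B : Finset (ySet k j) → ℂ := fun T' =>
        if (T'.map (Function.Embedding.subtype _)).card = j then
          ∑ S ∈ (xSet k j).powerset, c (insert (vtx k (2 * j)) (insert (vtx k (2 * j + 1)) S)) *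
            coeff (pexpo S (T'.map (Function.Embedding.subtype _))) (witness k j) else 0
      have hcardY : Fintype.card (ySet k j) = 2 * j + 1 := by
        rw [Fintype.card_coe, ySet, Finset.card_insert_of_notMem, Finset.card_image_of_injOn, Finset.card_range]
        · intro i hi i' hi' hv
          exact vtx_inj (by have := Finset.mem_range.mp hi; omega) (by have := Finset.mem_range.mp hi'; omega) hv
        · intro hm
          obtain ⟨i, hi, hv⟩ := Finset.mem_image.mp hm
          have := vtx_inj (by have := Finset.mem_range.mp hi; omega) (by omega) hv
          have := Finset.mem_range.mp hi; omega
      have hBzero : B = 0 := by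
        refine Literature.Combinatorics.Posets.BooleanOrderRaising.eq_zero_of_forall_sum_erase_eq_zero
          (K := ℂ) (i := j) (fun T' hT' => if_neg (by rwa [Finset.card_map])) (by rw [hcardY]; omega) ?_
        intro T'
        by_cases hT' : T'.card = j + 1
        · -- the up-operator identity from (α) at `|T| = j+1`
          have hsub : T'.map (Function.Embedding.subtype _) ⊆ ySet k j := by
            intro d hd
            obtain ⟨d', _, rfl⟩ := Finset.mem_map.mp hd
            exact d'.2
          have h1 := hA (T'.map (Function.Embedding.subtype _)) hsub (by rw [Finset.card_map, hT'])
          have hzero : ∑ S ∈ (xSet k j).powerset, c S *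
              coeff (pexpo S (T'.map (Function.Embedding.subtype _))) (witness k j) = 0 :=
            Finset.sum_eq_zero (fun S hS => by rw [hc0 S hS, zero_mul])
          rw [hzero, zero_add, Finset.sum_congr rfl (fun S _ => Finset.mul_sum _ _ _), Finset.sum_comm,
            Finset.sum_map] at h1
          rw [← h1]
          refine Finset.sum_congr rfl (fun x hx => ?_)
          have hcard : ((T'.erase x).map (Function.Embedding.subtype _)).card = j := by
            rw [Finset.card_map, Finset.card_erase_of_mem hx, hT']; rfl
          simp only [B, if_pos hcard, Finset.map_erase, Function.Embedding.coe_subtype]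
        · exact Finset.sum_eq_zero (fun x hx => if_neg (by
            rw [Finset.card_map, Finset.card_erase_of_mem hx]
            intro h'; apply hT'; have := T'.card_pos.mpr ⟨x, hx⟩; omega))
      intro T'' hT'' hTc''
      have hT''eq : (T''.subtype (· ∈ ySet k j)).map (Function.Embedding.subtype _) = T'' := by
        rw [Finset.subtype_map]; exact Finset.filter_true_of_mem (fun d hd => hT'' hd)
      have := congrFun hBzero (T''.subtype (· ∈ ySet k j))
      simp only [B, hT''eq, hTc'', if_true, Pi.zero_apply] at this
      exact this
    have hcab : ∀ S ∈ (xSet k j).powerset, c (insert (vtx k (2 * j)) (insert (vtx k (2 * j + 1)) S)) = 0 := by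
      refine ihj _ (fun T'' hT'' hTc'' => ?_)
      rcases Nat.lt_or_eq_of_le hTc'' with hlt | heq
      · exact hB_low T'' hT'' hlt
      · exact hB_top T'' hT'' heq
    -- conclusion: every `S ⊆ X_{j+1}` is of one of the four types
    intro S hS
    rw [Finset.mem_powerset, xSet_succ] at hS
    have hS' : (S.erase (vtx k (2 * j))).erase (vtx k (2 * j + 1)) ∈ (xSet k j).powerset := by
      rw [Finset.mem_powerset]
      intro v hv
      have hv1 := Finset.mem_erase.mp hv
      have hv2 := Finset.mem_erase.mp hv1.2
      rcases Finset.mem_insert.mp (hS hv2.2) with h1 | h1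
      · exact absurd h1 hv2.1
      rcases Finset.mem_insert.mp h1 with h2 | h2
      · exact absurd h2 hv1.1
      · exact h2
    by_cases ha : vtx k (2 * j) ∈ S
    · by_cases hb : vtx k (2 * j + 1) ∈ S
      · have := hcab _ hS'
        rwa [Finset.insert_erase (Finset.mem_erase.mpr ⟨hab.symm, hb⟩), Finset.insert_erase ha] at this
      · have := hca _ hS'
        rwa [Finset.erase_eq_of_notMem (fun hm => hb (Finset.mem_erase.mp hm).2), Finset.insert_erase ha] at this
    · by_cases hb : vtx k (2 * j + 1) ∈ S
      · have := hcb _ hS'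
        rwa [Finset.erase_eq_of_notMem ha, Finset.insert_erase hb] at this
      · have := hc0 _ hS'
        rwa [Finset.erase_eq_of_notMem ha, Finset.erase_eq_of_notMem hb] at this

/-! ## 2. Cube versus Hamming ball is hit at every height -/

/-- **CUBE versus HAMMING BALL (explicit witness).** Let `h = 2k+1`. For rows `u i` ranging injectively over
subsets of the first `2k` `x`-vertices and columns `w j` containing every subset of size `≤ k` of the `h`
`y`-vertices, the layout matrix of the weight-one brick product `F_k = witness k k` is nonsingular. (Square of size
`4^k` when `u` enumerates the cube `𝒫({0,…,2k−1})` and `w` the Hamming ball `{T : |T| ≤ k}`; no other hypothesis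
on `w` is used.) -/
theorem det_cubeBall_witness_ne_zero (k : ℕ) {r : ℕ} (u w : Fin r → Finset (Fin (2 * k + 1)))
    (hu : Function.Injective u) (hur : ∀ i, vtx k (2 * k) ∉ u i)
    (hwr : ∀ T : Finset (Fin (2 * k + 1)), T.card ≤ k → T ∈ Set.range w) :
    (Matrix.of fun i j : Fin r => coeff (pexpo (u i) (w j)) (witness k k)).det ≠ 0 := by
  classical
  intro hdet
  obtain ⟨v, hv, hvM⟩ := Matrix.exists_vecMul_eq_zero_iff.mpr hdet
  -- the coefficient function of the dependency, indexed by row SETS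
  let c : Finset (Fin (2 * k + 1)) → ℂ := fun S => ∑ i ∈ Finset.univ.filter (fun i => u i = S), v i
  have hmaps : ∀ i ∈ (Finset.univ : Finset (Fin r)), u i ∈ (xSet k k).powerset := fun i _ =>
    Finset.mem_powerset.mpr ((subset_xSet_self_iff k (u i)).mpr (hur i))
  have hc : ∀ T, T ⊆ ySet k k → T.card ≤ k →
      ∑ S ∈ (xSet k k).powerset, c S * coeff (pexpo S T) (witness k k) = 0 := by
    intro T _ hT
    obtain ⟨j, rfl⟩ := hwr T hT
    have hj := congrFun hvM j
    rw [Matrix.vecMul, dotProduct, Pi.zero_apply] at hj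
    simp only [Matrix.of_apply] at hj
    rw [← hj, ← Finset.sum_fiberwise_of_maps_to hmaps]
    refine Finset.sum_congr rfl (fun S _ => ?_)
    rw [Finset.sum_mul]
    refine Finset.sum_congr rfl (fun i hi => ?_)
    rw [(Finset.mem_filter.mp hi).2]
  have hzero := rows_independent k k le_rfl c hc
  apply hv
  funext i
  have hi := hzero (u i) (hmaps i (Finset.mem_univ _))
  have hfib : Finset.univ.filter (fun i' => u i' = u i) = {i} := by
    ext i'
    simp only [Finset.mem_filter, Finset.mem_univ, true_and, Finset.mem_singleton]
    exact ⟨fun h' => hu h', fun h' => by rw [h']⟩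
  simp only [c, hfib, Finset.sum_singleton] at hi
  exact hi

/-- **CUBE versus HAMMING BALL is hit by `VP` at every height.** For every `k ≥ 1`, `h = 2k+1`: some
`f ∈ SmallCircuits ℂ (h+h) 8` (the degree-`2h` truncation of `F_k`, `k(k+2)` weight-one bricks) makes item 19717's
layout matrix of «rows = subsets of the first `2k` `x`-vertices (injective), columns ⊇ all `y`-subsets of size `≤ k`»
nonsingular. -/
theorem cubeBall_hit (k : ℕ) (hk : 1 ≤ k) {r : ℕ} (u w : Fin r → Finset (Fin (2 * k + 1)))
    (hu : Function.Injective u) (hur : ∀ i, vtx k (2 * k) ∉ u i)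
    (hwr : ∀ T : Finset (Fin (2 * k + 1)), T.card ≤ k → T ∈ Set.range w) :
    ∃ f ∈ SmallCircuits ℂ ((2 * k + 1) + (2 * k + 1)) 8,
      (Matrix.of fun i j : Fin r => MvPolynomial.coeff
        (∑ a ∈ u i, Finsupp.single (Fin.castAdd (2 * k + 1) a) 1 +
          ∑ c ∈ w j, Finsupp.single (Fin.natAdd (2 * k + 1) c) 1) f).det ≠ 0 := by
  obtain ⟨hdeg, hcoeff, hsize⟩ := truncation_spec (witness k k) ((2 * k + 1) + (2 * k + 1))
  refine ⟨∑ e ∈ Finset.range ((2 * k + 1) + (2 * k + 1) + 1), homogeneousComponent e (witness k k),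
    ⟨hdeg, hsize.trans ?_⟩, ?_⟩
  · -- (2h+2)² · k((h+2)(2h+4)+1) + 2h+1 ≤ (2h)^8, h = 2k+1
    have hcw := complexity_witness_le k k
    generalize hN : complexity (witness k k) = N at hcw ⊢
    generalize hh : 2 * k + 1 = h at hcw ⊢
    have hkh : k ≤ h := by omega
    have h3 : 3 ≤ h := by omega
    calc (h + h + 2) ^ 2 * N + (h + h + 1)
        ≤ (h + h + 2) ^ 2 * (k * ((h + 2) * (2 * h + 4) + 1)) + (h + h + 1) := by gcongr
      _ ≤ (3 * h) ^ 2 * (h * (2 * h * (4 * h) + 1)) + 3 * h := by gcongr <;> omega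
      _ ≤ (3 * h) ^ 2 * (h * (9 * h * h)) + 3 * (h * h * h * h * h) := by
          gcongr
          · nlinarith
          · calc h = h * 1 * 1 * 1 * 1 := by ring
              _ ≤ h * h * h * h * h := by gcongr <;> omega
      _ = 84 * (h * h * h * h * h) * 1 := by ring
      _ ≤ 256 * (h * h * h * h * h) * (h * h * h) := by
          gcongr
          · norm_num
          · calc 1 = 1 * 1 * 1 := by ring
              _ ≤ h * h * h := by gcongr <;> omega
      _ = (h + h) ^ 8 := by ring
  · have hmat : (Matrix.of fun i j : Fin r => MvPolynomial.coeff
        (∑ a ∈ u i, Finsupp.single (Fin.castAdd (2 * k + 1) a) 1 +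
          ∑ c ∈ w j, Finsupp.single (Fin.natAdd (2 * k + 1) c) 1)
        (∑ e ∈ Finset.range ((2 * k + 1) + (2 * k + 1) + 1), homogeneousComponent e (witness k k))) =
        Matrix.of fun i j : Fin r => coeff (pexpo (u i) (w j)) (witness k k) := by
      ext i j
      rw [Matrix.of_apply, Matrix.of_apply, hcoeff _ (degree_partitionExpo_le _ _), pexpo]
    rw [hmat]
    exact det_cubeBall_witness_ne_zero k u w hu hur hwr

end

end Summit.ValiantsHypothesis.ValiantsHypothesis.Theorems.BarrierLever.CubeBall
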